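import Summits.QuantumAdvantage.QuantumAdvantage.Theses.LinnikCubicClassGroups
import Literature.NumberTheory.CubicFields.PureCubicDegreeOnePrimeCodes
import Literature.Computability.Cryptography.PureCubicLatticeFP

/-!
# Crux `LinnikCubicClassGroups.PureCubicClassGroupFBQP` (stmt-QuantumAdvantage-11544) — stub `stub_degreeOnePrimeCodes`

Line `arakelov-giant-step-cycle`, stub `stub_degreeOnePrimeCodes` (S5b-P3): the degree-one prime ideals
of the pure cubic field `K = ℚ(θ)`, `θ³ = ab²` (`ab` squarefree, `≠ 1`), above a rational prime
`p ∤ 3ab`, as CANONICAL LATTICE CODES over the landed vocabulary `PureCubicCodes.Mem/Canon` of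
`Literature/NumberTheory/CubicFields/PureCubicLatticeCodes.lean` (Dedekind's basis `(1, θ, θ₂ = θ²/b)`).

PROGRAM: `primeL ((a, b), (ord, (p, r))) = latProd ((a, b), (ord, latOfGens 1 [(p,0,0), (-r,1,0), (0,0,p)]))`
— the canonical code of the `ℤ`-span of the products `𝓞_K · L`, `L = ℤ p + ℤ (θ - r) + ℤ p θ₂`, i.e. of
the ideal `p 𝓞_K + (θ - r) 𝓞_K` (`ord` = a canonical code of `𝓞_K`, an input). It is typed polynomial
time (`codeFP_primeL`: composition of the landed `latProdC`, `codeOfC`, `hnfListC`).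
SEMANTICS (`Literature/NumberTheory/CubicFields/PureCubicDegreeOnePrimeCodes.lean`, theorem
`PureCubicCodes.degreeOnePrimeCodes`, from `latProd_spec` and the Dedekind–Kummer file
`Literature/NumberTheory/NumberFields/PureCubicDegreeOnePrimes.lean`): for a root `r < p` of
`X³ ≡ ab² (mod p)` the ideal `(p, θ - r)` is a non-zero prime of norm `p`; distinct roots give
distinct ideals; every prime of norm `p` is some `(p, θ - r)`.
-/

-- the problem namespace repeats the summit name (`QuantumAdvantage.QuantumAdvantage`)
set_option linter.dupNamespace false

namespace Summit.QuantumAdvantage.QuantumAdvantage.Theorems.LinnikCubicClassGroups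

open Literature.Computability.Complexity (CodeFP)
open Literature.Computability.Complexity.CodeFP (pairE strE natE intE bitE unE rawE)
open Literature.NumberTheory.CubicFields (PureCubicCodes.Mem PureCubicCodes.Canon)
open scoped NumberField
open scoped nonZeroDivisors
open Literature.NumberTheory.CubicFields.PureCubicCodes (latProd latOfGens Row degreeOnePrimeCodes)
open Literature.Computability.Cryptography.PureCubicFP (latProdC codeOfC hnfListC)
open Literature.Computability.Complexity.CodeFP (fst snd const intOfNat intNeg)

/-- **The program `primeL` is typed polynomial time**: `primeL ((a, b), (c, (p, r))) =
latProd ((a, b), (c, latOfGens 1 [(p, 0, 0), (-r, 1, 0), (0, 0, p)]))` is a fixed composition of the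
landed `CodeFP` programs `latProd`, `codeOf`, `hnf` (three rows) with projections and constants. -/
theorem codeFP_primeL :
    CodeFP (pairE (pairE natE natE) (pairE (pairE natE (rawE intE)) (pairE natE natE))) (pairE natE (rawE intE))
      (fun q : (ℕ × ℕ) × ((ℕ × List ℤ) × (ℕ × ℕ)) => latProd (q.1, (q.2.1, latOfGens 1
        [((q.2.2.1 : ℤ), 0, 0), (-(q.2.2.2 : ℤ), 1, 0), (0, 0, (q.2.2.1 : ℤ))]))) := by
  have hab : CodeFP (pairE (pairE natE natE) (pairE (pairE natE (rawE intE)) (pairE natE natE))) (pairE natE natE)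
      (fun q => q.1) := fst _ _
  have hc : CodeFP (pairE (pairE natE natE) (pairE (pairE natE (rawE intE)) (pairE natE natE))) (pairE natE (rawE intE))
      (fun q => q.2.1) := (snd _ _).fst'
  have hp : CodeFP (pairE (pairE natE natE) (pairE (pairE natE (rawE intE)) (pairE natE natE))) intE
      (fun q => (q.2.2.1 : ℤ)) := by
    exact (intOfNat.comp (snd _ _).snd'.fst' :)
  have hr : CodeFP (pairE (pairE natE natE) (pairE (pairE natE (rawE intE)) (pairE natE natE))) intE
      (fun q => -(q.2.2.2 : ℤ)) := by
    exact (intNeg.comp (intOfNat.comp (snd _ _).snd'.snd') :)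
  have z : CodeFP (pairE (pairE natE natE) (pairE (pairE natE (rawE intE)) (pairE natE natE))) intE
      (fun _ => (0 : ℤ)) := const _ 0
  have one : CodeFP (pairE (pairE natE natE) (pairE (pairE natE (rawE intE)) (pairE natE natE))) intE
      (fun _ => (1 : ℤ)) := const _ 1
  have g1 : CodeFP (pairE (pairE natE natE) (pairE (pairE natE (rawE intE)) (pairE natE natE))) (pairE intE (pairE intE intE))
      (fun q => (((q.2.2.1 : ℤ), 0, 0) : Row)) := by
    exact (hp.pair (z.pair z) :)
  have g2 : CodeFP (pairE (pairE natE natE) (pairE (pairE natE (rawE intE)) (pairE natE natE))) (pairE intE (pairE intE intE))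
      (fun q => ((-(q.2.2.2 : ℤ), 1, 0) : Row)) := by
    exact (hr.pair (one.pair z) :)
  have g3 : CodeFP (pairE (pairE natE natE) (pairE (pairE natE (rawE intE)) (pairE natE natE))) (pairE intE (pairE intE intE))
      (fun q => ((0, 0, (q.2.2.1 : ℤ)) : Row)) := by
    exact (z.pair (z.pair hp) :)
  have hD : CodeFP (pairE (pairE natE natE) (pairE (pairE natE (rawE intE)) (pairE natE natE))) natE
      (fun _ => (1 : ℕ)) := const _ 1
  have hh := hnfListC (eσ := pairE (pairE natE natE) (pairE (pairE natE (rawE intE)) (pairE natE natE))) [_, _, _] (by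
    intro f hf
    simp only [List.mem_cons, List.not_mem_nil, or_false] at hf
    rcases hf with rfl | rfl | rfl
    exacts [g1, g2, g3])
  have hL : CodeFP (pairE (pairE natE natE) (pairE (pairE natE (rawE intE)) (pairE natE natE))) (pairE natE (rawE intE))
      (fun q => latOfGens 1 [((q.2.2.1 : ℤ), 0, 0), (-(q.2.2.2 : ℤ), 1, 0), (0, 0, (q.2.2.1 : ℤ))]) := by
    exact (codeOfC.comp (hD.pair hh) :)
  exact (latProdC.comp (hab.pair (hc.pair hL)) :)

-- the registered signature names the (unused) non-zero-divisor witness `hP`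
set_option linter.unusedVariables false in
/-- **Stub `stub_degreeOnePrimeCodes`** (S5b-P3 of the line `arakelov-giant-step-cycle`; Dedekind–Kummer
for the degree-one primes of `ℚ(∛(ab²))` as canonical lattice codes). The program is
`primeL ((a, b), (ord, (p, r))) = latProd ((a, b), (ord, latOfGens 1 [(p, 0, 0), (-r, 1, 0), (0, 0, p)]))`,
the canonical code of `𝓞_K · (ℤ p + ℤ (θ - r) + ℤ p θ₂) = p 𝓞_K + (θ - r) 𝓞_K`; it is `CodeFP`
(`codeFP_primeL`), and the number theory is `PureCubicCodes.degreeOnePrimeCodes`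
(`Literature/NumberTheory/CubicFields/PureCubicDegreeOnePrimeCodes.lean`): for a prime `p ∤ 3ab` and a
root `r < p` of `X³ ≡ ab² (mod p)` the ideal `(p, θ - r)` is a non-zero prime of norm `p`
(Dedekind–Kummer, `p ∤ 27a²b⁴ ⊇` the conductor of `ℤ[θ]`), distinct roots give distinct ideals
(`r - r' ∈ (p, θ - r) ∩ ℤ = pℤ`), and every prime of norm `p` is some `(p, θ - r)` (its residue field
is `𝔽_p`, `θ ↦` a root). -/
theorem stub_degreeOnePrimeCodes :
    ∃ primeL : (ℕ × ℕ) × ((ℕ × List ℤ) × (ℕ × ℕ)) → ℕ × List ℤ,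
      CodeFP (pairE (pairE natE natE) (pairE (pairE natE (rawE intE)) (pairE natE natE))) (pairE natE (rawE intE)) primeL ∧
    ∀ (a b : ℕ), Squarefree (a * b) → a * b ≠ 1 →
      ∀ (K : Type) [Field K] [NumberField K], Module.finrank ℚ K = 3 →
        ∀ θ : K, θ ^ 3 = ((a * b ^ 2 : ℕ) : K) →
        ∀ ord : ℕ × List ℤ, PureCubicCodes.Canon ord →
          (∀ φ : K, PureCubicCodes.Mem θ b ord φ ↔ IsIntegral ℤ φ) →
        ∀ p : ℕ, p.Prime → ¬ p ∣ 3 * (a * b) →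
          (∀ r : ℕ, r < p → r ^ 3 % p = (a * b ^ 2) % p →
            PureCubicCodes.Canon (primeL ((a, b), (ord, (p, r)))) ∧
            ∃ (P : Ideal (𝓞 K)) (hP : P ∈ nonZeroDivisors (Ideal (𝓞 K))), P.IsPrime ∧ Ideal.absNorm P = p ∧
              ∀ φ : K, PureCubicCodes.Mem θ b (primeL ((a, b), (ord, (p, r)))) φ ↔
                ∃ ψ : 𝓞 K, ψ ∈ P ∧ (ψ : K) = φ) ∧
          (∀ r r' : ℕ, r < p → r' < p → r ^ 3 % p = (a * b ^ 2) % p → r' ^ 3 % p = (a * b ^ 2) % p →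
            (∀ φ : K, PureCubicCodes.Mem θ b (primeL ((a, b), (ord, (p, r)))) φ ↔
              PureCubicCodes.Mem θ b (primeL ((a, b), (ord, (p, r')))) φ) → r = r') ∧
          (∀ Q : Ideal (𝓞 K), Q.IsPrime → Ideal.absNorm Q = p →
            ∃ r : ℕ, r < p ∧ r ^ 3 % p = (a * b ^ 2) % p ∧
              ∀ φ : K, PureCubicCodes.Mem θ b (primeL ((a, b), (ord, (p, r)))) φ ↔
                ∃ ψ : 𝓞 K, ψ ∈ Q ∧ (ψ : K) = φ) := by
  refine ⟨fun q => latProd (q.1, (q.2.1, latOfGens 1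
    [((q.2.2.1 : ℤ), 0, 0), (-(q.2.2.2 : ℤ), 1, 0), (0, 0, (q.2.2.1 : ℤ))])), codeFP_primeL, ?_⟩
  intro a b hab hab1 K _ _ h3 θ hθ ord hord hmem p hp hpab
  exact degreeOnePrimeCodes hab hab1 K h3 θ hθ ord hord hmem p hp hpab

end Summit.QuantumAdvantage.QuantumAdvantage.Theorems.LinnikCubicClassGroups
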